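import Mathlib
import HarnessLib
import Literature.Probability.MarkovChains.TotalVariation

/-!
# Seneta's ergodicity coefficient `τ`, Dobrushin contraction, and Seneta's 1988 perturbation bound `‖π̃ − π‖₁ ≤ ‖P̃ − P‖_∞ / (1 − τ(P))`

HONEST FRAMING: exact (Metropolis-corrected) sampling algorithms for lattice gauge theory; figures
of merit are autocorrelation/cost numbers at stated couplings and volumes; no continuum-physics claim.

Row conventions of `MetropolisHastings.lean` / `TotalVariation.lean` (`P x y` = probability of
`x → y`; laws are row vectors; `v ᵥ* P` is one step, `= stepLaw P v`).  For a square real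
matrix `B`:

* `ergodicCoeff B = ½ max_{i,j} Σ_k |B_ik − B_jk|` — SENETA'S ERGODICITY COEFFICIENT `τ(B)`; for a
  stochastic `B` it is Dobrushin's `τ₁` [cite: KirklandNeumann2012, §5.3 eq. (5.14)];
  [cite: FasinoTudisco2020, §4.1 Theorem 4 (column convention)]; `τ ≥ 0`, `τ(B) ≤ ‖B‖_∞`
  (`ergodicCoeff_le_of_row_norm_le`) [cite: FasinoTudisco2020, §4.1 Theorem 1];
* `norm_vecMul_le_mul_ergodicCoeff` — **KN LEMMA 5.3.4 (a)**: `‖vB‖₁ ≤ ‖v‖₁ τ(B)` for every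
  ZERO-SUM row vector `v` and every `B`; `abs_sum_mul_le_of_sum_eq_zero` — **KN LEMMA 5.3.4 (b)**
  (Alpin–Gabassov): `|vᵗz| ≤ ‖v‖₁ · max_{i,j}(z_i − z_j)/2` [cite: KirklandNeumann2012, §5.3
  Lemma 5.3.4].  Proof here: the coupling decomposition `m·v = Σ_{i,j} v⁺_i v⁻_j (e_i − e_j)`,
  `m = Σv⁺ = Σv⁻ = ‖v‖₁/2` (private `sum_mul_coupling`), in place of the book's induction on `n`;
* `norm_vecMul_sub_vecMul_le`, `tvDist_stepLaw_le_mul` — **DOBRUSHIN CONTRACTION**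
  `‖μB − νB‖₁ ≤ τ(B)‖μ − ν‖₁` (`Σμ = Σν`), sharpening `TotalVariation.tvDist_stepLaw_le`
  by the factor `τ(P) ≤ 1` [cite: KirklandNeumann2012, §5.3 Remark 5.3.7];
  [cite: FasinoTudisco2020, §4.1 (definition of `τ_p` as a Lipschitz constant), Theorem 3];
* `rowDiff_eq_two_sub`, `ergodicCoeff_le_one`, `ergodicCoeff_le_one_sub`,
  `ergodicCoeff_le_one_sub_of_minorised` — the overlap formula
  `Σ_k |P_ik − P_jk| = 2 − 2Σ_k min(P_ik, P_jk)`, hence `τ(P) ≤ 1`, and `τ(P) ≤ 1 − δ` under a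
  uniform overlap or a DOEBLIN MINORISATION `P_ik ≥ δ ν_k` [cite: FasinoTudisco2020, §4.1
  Theorem 4 (`τ₁(P) = 1 − min_{jk} Σ_i min{P_ij, P_ik}`)];
* `norm_vecMul_sub_le` — `‖π̃E‖₁ ≤ ‖E‖_∞` for a probability vector `π̃`, where throughout
  "`‖E‖_∞ ≤ ε`" is written `∀ x, Σ_y |P̃ x y − P x y| ≤ ε` [cite: KirklandNeumann2012, §5.3 proof
  of Theorem 5.3.5];
* `norm_sub_le_div_one_sub_ergodicCoeff` — **SENETA'S 1988 BOUND**: `πP = π`, `π̃P̃ = π̃`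
  (probability vectors), `τ(P) < 1` ⇒ `‖π̃ − π‖₁ ≤ ‖P̃ − P‖_∞ / (1 − τ(P))` — no irreducibility
  and no group inverse [cite: FasinoTudisco2020, §4.1 Theorem 2 (Seneta 1988)] (its Doeblin
  form `‖π̃ − π‖_TV ≤ ‖E‖_∞/(2δ)` is `StationaryPerturbation.tvDist_le_div_of_ergodicCoeff_le`).

Everything is PROVED (0 named facts).  Companion files: `GroupInverse.lean` (Meyer's identity),
`StationaryPerturbation.lean` (the condition numbers of KN Theorem 5.3.5).

Context (cell pub-lqcd, row 38 `r2-scope`, R2-SCOPE.md §3 E5 / E4 / X-5c; §5.3 detector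
thresholds): an exact independence (flow) sampler whose importance weights are bounded has a
Doeblin constant `δ`, so an accept-step defect of kernel size `‖E‖_∞ ≤ ε` biases its stationary
law by at most `ε/(2δ)` in total variation.

## References

* S. J. Kirkland, M. Neumann, *Group Inverses of M-Matrices and Their Applications*, CRC Press
  2012, §5.3 eq. (5.14), Lemma 5.3.4, Remark 5.3.7, proof of Theorem 5.3.5 [KirklandNeumann2012].
* D. Fasino, F. Tudisco, *Ergodicity coefficients for higher-order stochastic processes*, SIAM J.
  Math. Data Sci. 2 (2020) 740–769 = arXiv:1907.04841, §4.1 Theorems 1–4 [FasinoTudisco2020].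
* E. Seneta, Adv. Appl. Probab. 20 (1988) 228–230 [Seneta1988] — original of Theorem 2, cited via
  Fasino–Tudisco (not read); R. L. Dobrushin 1956 (the coefficient `τ₁`), via the same.
* D. A. Levin, Y. Peres, *Markov Chains and Mixing Times* (2017) §4.1–4.4 [LevinPeres2017]
  (total variation; the conventions of `TotalVariation.lean`).
-/

namespace Literature.Probability.MarkovChains

open Finset Matrix

variable {X : Type*} [Fintype X] [DecidableEq X]

omit [DecidableEq X] in
/-- `(v M)_j = Σ_i v_i M_ij`. [folklore] -/
private theorem vecMul_apply' (v : X → ℝ) (M : Matrix X X ℝ) (j : X) :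
    (v ᵥ* M) j = ∑ i, v i * M i j := rfl

omit [DecidableEq X] in
/-- A probability vector lives on a nonempty state space. [folklore] -/
private theorem nonempty_of_sum_eq_one {π : X → ℝ} (hπ1 : ∑ x, π x = 1) : Nonempty X := by
  by_contra h
  rw [not_nonempty_iff] at h
  rw [univ_eq_empty, sum_empty] at hπ1
  exact zero_ne_one hπ1

/-! ## The ergodicity coefficient `τ(B)` and the two coupling inequalities (KN Lemma 5.3.4) -/

section Ergodicity

omit [DecidableEq X]

/-- SENETA'S ERGODICITY COEFFICIENT of a square matrix (row convention):
`τ(B) = ½ max_{i,j} Σ_k |B_ik − B_jk|` — for a stochastic `B` this is Dobrushin's coefficient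
`τ₁`. [cite: KirklandNeumann2012, §5.3 eq. (5.14)]; [cite: FasinoTudisco2020, §4.1 Theorem 4
(`τ₁(P) = ½ max_{j,k} Σ_i |P_ij − P_ik|`, column convention)] -/
noncomputable def ergodicCoeff (B : Matrix X X ℝ) : ℝ :=
  (1 / 2) * ⨆ p : X × X, ∑ k, |B p.1 k - B p.2 k|

/-- Each pair of rows is within `2τ(B)` in `ℓ¹`. [cite: KirklandNeumann2012, §5.3 eq. (5.14)] -/
theorem rowDiff_le_two_mul_ergodicCoeff (B : Matrix X X ℝ) (i j : X) :
    ∑ k, |B i k - B j k| ≤ 2 * ergodicCoeff B := by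
  have h := le_ciSup (f := fun p : X × X => ∑ k, |B p.1 k - B p.2 k|)
    (Set.finite_range _).bddAbove (i, j)
  unfold ergodicCoeff
  linarith

/-- `τ(B) ≥ 0`. [cite: FasinoTudisco2020, §4.1 Theorem 1 (`0 ≤ τ_p(P)`)] -/
theorem ergodicCoeff_nonneg (B : Matrix X X ℝ) : 0 ≤ ergodicCoeff B :=
  mul_nonneg (by norm_num) (Real.iSup_nonneg fun _ => sum_nonneg fun _ _ => abs_nonneg _)

/-- `τ(B) ≤ c` as soon as every pair of rows is within `2c` in `ℓ¹` (`c ≥ 0`) — the `max` in the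
definition. [cite: KirklandNeumann2012, §5.3 eq. (5.14)] -/
theorem ergodicCoeff_le {B : Matrix X X ℝ} {c : ℝ} (hc : 0 ≤ c)
    (h : ∀ i j, ∑ k, |B i k - B j k| ≤ 2 * c) : ergodicCoeff B ≤ c := by
  unfold ergodicCoeff
  rcases isEmpty_or_nonempty (X × X) with hX | hX
  · rw [Real.iSup_of_isEmpty]; linarith
  · have : (⨆ p : X × X, ∑ k, |B p.1 k - B p.2 k|) ≤ 2 * c := ciSup_le fun p => h p.1 p.2
    linarith

/-- `τ(B) ≤ ‖B‖_∞` (the maximal absolute row sum). [cite: FasinoTudisco2020, §4.1 Theorem 1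
(`0 ≤ τ_p(P) ≤ ‖P‖_p`)] -/
theorem ergodicCoeff_le_of_row_norm_le [Nonempty X] {B : Matrix X X ℝ} {b : ℝ}
    (h : ∀ i, ∑ k, |B i k| ≤ b) : ergodicCoeff B ≤ b := by
  obtain ⟨i₀⟩ := ‹Nonempty X›
  have hb : 0 ≤ b := (sum_nonneg fun k _ => abs_nonneg (B i₀ k)).trans (h i₀)
  refine ergodicCoeff_le hb fun i j => ?_
  calc ∑ k, |B i k - B j k| ≤ ∑ k, (|B i k| + |B j k|) := sum_le_sum fun k _ => abs_sub _ _
    _ = ∑ k, |B i k| + ∑ k, |B j k| := sum_add_distrib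
    _ ≤ 2 * b := by linarith [h i, h j]

/-! ### The coupling decomposition of a zero-sum vector and KN Lemma 5.3.4 -/

/-- Positive/negative parts of a zero-sum vector: `v = v⁺ − v⁻`, `|v| = v⁺ + v⁻`,
`Σ v⁻ = Σ v⁺ =: m`, `Σ |v| = 2m`. [folklore] -/
private theorem posNeg_facts {v : X → ℝ} (hv : ∑ i, v i = 0) :
    (∀ i, v i = max (v i) 0 - max (-v i) 0) ∧ (∀ i, |v i| = max (v i) 0 + max (-v i) 0) ∧
      ∑ i, max (-v i) 0 = ∑ i, max (v i) 0 ∧ ∑ i, |v i| = 2 * ∑ i, max (v i) 0 := by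
  have hsplit : ∀ i, v i = max (v i) 0 - max (-v i) 0 :=
    fun i => (max_zero_sub_max_neg_zero_eq_self (v i)).symm
  have habs : ∀ i, |v i| = max (v i) 0 + max (-v i) 0 :=
    fun i => (max_zero_add_max_neg_zero_eq_abs_self (v i)).symm
  have hm : ∑ i, max (-v i) 0 = ∑ i, max (v i) 0 := by
    have h : ∑ i, (max (v i) 0 - max (-v i) 0) = ∑ i, v i :=
      sum_congr rfl fun i _ => (hsplit i).symm
    rw [hv, sum_sub_distrib] at h
    linarith
  refine ⟨hsplit, habs, hm, ?_⟩
  rw [sum_congr rfl fun i (_ : i ∈ univ) => habs i, sum_add_distrib, hm]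
  ring

/-- A zero-sum vector with `Σ v⁺ = 0` vanishes. [folklore] -/
private theorem eq_zero_of_sum_pos_eq_zero {v : X → ℝ} (hv : ∑ i, v i = 0)
    (hm : ∑ i, max (v i) 0 = 0) : v = 0 := by
  obtain ⟨hsplit, -, hmm, -⟩ := posNeg_facts hv
  have hp : ∀ i, max (v i) 0 = 0 := fun i =>
    (sum_eq_zero_iff_of_nonneg fun j _ => le_max_right (v j) 0).1 hm i (mem_univ i)
  have hn : ∀ i, max (-v i) 0 = 0 := fun i =>
    (sum_eq_zero_iff_of_nonneg fun j _ => le_max_right (-v j) 0).1 (hmm.trans hm) i (mem_univ i)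
  funext i
  rw [hsplit i, hp i, hn i, sub_zero, Pi.zero_apply]

/-- THE COUPLING DECOMPOSITION: for a zero-sum `v` with `m = Σ v⁺ = Σ v⁻`,
`m · Σ_i v_i F_i = Σ_i Σ_j v⁺_i v⁻_j (F_i − F_j)` — i.e. `v = (1/m) Σ_{i,j} v⁺_i v⁻_j (e_i − e_j)`,
a representation of `v` by the pairs `(e_i − e_j)` with total weight `Σ|a(i,j)| = ‖v‖₁` as in the
claim opening KN's proof of Lemma 5.3.4. [folklore] -/
private theorem sum_mul_coupling {v : X → ℝ} (hv : ∑ i, v i = 0) (F : X → ℝ) :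
    (∑ i, max (v i) 0) * ∑ i, v i * F i
      = ∑ i, ∑ j, max (v i) 0 * max (-v j) 0 * (F i - F j) := by
  obtain ⟨hsplit, -, hm, -⟩ := posNeg_facts hv
  set vp : X → ℝ := fun i => max (v i) 0 with hvp
  set vm : X → ℝ := fun i => max (-v i) 0 with hvm
  have h1 : ∑ i, ∑ j, vp i * vm j * (F i - F j)
      = (∑ j, vm j) * ∑ i, vp i * F i - (∑ i, vp i) * ∑ j, vm j * F j := by
    simp_rw [mul_sub, sum_sub_distrib]
    congr 1
    · rw [mul_sum]
      refine sum_congr rfl fun i _ => ?_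
      rw [sum_mul]
      exact sum_congr rfl fun j _ => by ring
    · rw [sum_comm, mul_sum]
      refine sum_congr rfl fun j _ => ?_
      rw [sum_mul]
      exact sum_congr rfl fun i _ => by ring
  rw [h1, hm, ← mul_sub, ← sum_sub_distrib]
  congr 1
  exact sum_congr rfl fun i _ => by rw [hsplit i]; ring

/-- **KN LEMMA 5.3.4 (a)** (Seneta): for a zero-sum row vector `v` and ANY square `B`,
`‖vB‖₁ ≤ ‖v‖₁ τ(B)`. [cite: KirklandNeumann2012, §5.3 Lemma 5.3.4 (a)
("`‖Bᵗv‖₁ ≤ ‖v‖₁ ½ max_{i,j} Σ_k |b_ik − b_jk|`")] -/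
theorem norm_vecMul_le_mul_ergodicCoeff {v : X → ℝ} (hv : ∑ i, v i = 0) (B : Matrix X X ℝ) :
    ∑ k, |(v ᵥ* B) k| ≤ (∑ i, |v i|) * ergodicCoeff B := by
  obtain ⟨hsplit, -, hm, hnorm⟩ := posNeg_facts hv
  set vp : X → ℝ := fun i => max (v i) 0 with hvp
  set vm : X → ℝ := fun i => max (-v i) 0 with hvm
  set m := ∑ i, vp i with hmdef
  have hvp0 : ∀ i, 0 ≤ vp i := fun i => le_max_right _ _
  have hvm0 : ∀ i, 0 ≤ vm i := fun i => le_max_right _ _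
  have hm0 : 0 ≤ m := sum_nonneg fun i _ => hvp0 i
  rcases hm0.eq_or_lt with hm00 | hmpos
  · have hv0 : v = 0 := eq_zero_of_sum_pos_eq_zero hv hm00.symm
    rw [hv0, zero_vecMul]
    simp
  · have key : ∀ k, m * (v ᵥ* B) k = ∑ i, ∑ j, vp i * vm j * (B i k - B j k) := fun k => by
      rw [vecMul_apply']
      exact sum_mul_coupling hv fun i => B i k
    have h1 : m * ∑ k, |(v ᵥ* B) k| ≤ m * ((∑ i, |v i|) * ergodicCoeff B) :=
      calc m * ∑ k, |(v ᵥ* B) k| = ∑ k, |m * (v ᵥ* B) k| := by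
            rw [mul_sum]
            exact sum_congr rfl fun k _ => by rw [abs_mul, abs_of_pos hmpos]
        _ = ∑ k, |∑ i, ∑ j, vp i * vm j * (B i k - B j k)| := by simp_rw [key]
        _ ≤ ∑ k, ∑ i, ∑ j, vp i * vm j * |B i k - B j k| := by
            refine sum_le_sum fun k _ => (abs_sum_le_sum_abs _ _).trans
              (sum_le_sum fun i _ => (abs_sum_le_sum_abs _ _).trans (sum_le_sum fun j _ => ?_))
            rw [abs_mul, abs_of_nonneg (mul_nonneg (hvp0 i) (hvm0 j))]
        _ = ∑ i, ∑ j, vp i * vm j * ∑ k, |B i k - B j k| := by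
            rw [sum_comm]
            refine sum_congr rfl fun i _ => ?_
            rw [sum_comm]
            exact sum_congr rfl fun j _ => by rw [mul_sum]
        _ ≤ ∑ i, ∑ j, vp i * vm j * (2 * ergodicCoeff B) :=
            sum_le_sum fun i _ => sum_le_sum fun j _ =>
              mul_le_mul_of_nonneg_left (rowDiff_le_two_mul_ergodicCoeff B i j)
                (mul_nonneg (hvp0 i) (hvm0 j))
        _ = (∑ i, vp i) * (∑ j, vm j) * (2 * ergodicCoeff B) := by
            rw [Finset.sum_mul_sum, sum_mul]
            exact sum_congr rfl fun i _ => by rw [sum_mul]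
        _ = m * ((∑ i, |v i|) * ergodicCoeff B) := by rw [hm, hnorm]; ring
    exact le_of_mul_le_mul_left h1 hmpos

/-- **KN LEMMA 5.3.4 (b)** (Alpin–Gabassov): for a zero-sum `v` and any `z` whose entries differ
pairwise by at most `d`, `|vᵗz| ≤ ‖v‖₁ d / 2`. [cite: KirklandNeumann2012, §5.3 Lemma 5.3.4 (b)
("`|vᵗz| ≤ ‖v‖₁ max_{i,j} |z_i − z_j| / 2`")] -/
theorem abs_sum_mul_le_of_sum_eq_zero {v : X → ℝ} (hv : ∑ i, v i = 0) {z : X → ℝ} {d : ℝ}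
    (hz : ∀ i j, z i - z j ≤ d) : |∑ i, v i * z i| ≤ (∑ i, |v i|) / 2 * d := by
  obtain ⟨hsplit, -, hm, hnorm⟩ := posNeg_facts hv
  set vp : X → ℝ := fun i => max (v i) 0 with hvp
  set vm : X → ℝ := fun i => max (-v i) 0 with hvm
  set m := ∑ i, vp i with hmdef
  have hvp0 : ∀ i, 0 ≤ vp i := fun i => le_max_right _ _
  have hvm0 : ∀ i, 0 ≤ vm i := fun i => le_max_right _ _
  have hm0 : 0 ≤ m := sum_nonneg fun i _ => hvp0 i
  rcases hm0.eq_or_lt with hm00 | hmpos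
  · have hv0 : v = 0 := eq_zero_of_sum_pos_eq_zero hv hm00.symm
    subst hv0
    simp
  · have key : m * ∑ i, v i * z i = ∑ i, ∑ j, vp i * vm j * (z i - z j) := sum_mul_coupling hv z
    have hprod : ∑ i, ∑ j, vp i * vm j * d = m * m * d :=
      calc ∑ i, ∑ j, vp i * vm j * d = (∑ i, vp i) * (∑ j, vm j) * d := by
            rw [Finset.sum_mul_sum, sum_mul]
            exact sum_congr rfl fun i _ => by rw [sum_mul]
        _ = m * m * d := by rw [hm]
    have hub : ∑ i, ∑ j, vp i * vm j * (z i - z j) ≤ m * m * d :=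
      calc ∑ i, ∑ j, vp i * vm j * (z i - z j) ≤ ∑ i, ∑ j, vp i * vm j * d :=
            sum_le_sum fun i _ => sum_le_sum fun j _ =>
              mul_le_mul_of_nonneg_left (hz i j) (mul_nonneg (hvp0 i) (hvm0 j))
        _ = m * m * d := hprod
    have hlb : -(m * m * d) ≤ ∑ i, ∑ j, vp i * vm j * (z i - z j) := by
      have : ∑ i, ∑ j, vp i * vm j * (z i - z j) ≥ ∑ i, ∑ j, vp i * vm j * (-d) :=
        sum_le_sum fun i _ => sum_le_sum fun j _ =>
          mul_le_mul_of_nonneg_left (by linarith [hz j i]) (mul_nonneg (hvp0 i) (hvm0 j))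
      have h2 : ∑ i, ∑ j, vp i * vm j * (-d) = -(m * m * d) := by
        rw [← hprod, ← sum_neg_distrib]
        refine sum_congr rfl fun i _ => ?_
        rw [← sum_neg_distrib]
        exact sum_congr rfl fun j _ => by ring
      linarith
    have h3 : m * |∑ i, v i * z i| ≤ m * ((∑ i, |v i|) / 2 * d) := by
      rw [← abs_of_pos hmpos, ← abs_mul, abs_of_pos hmpos, key, hnorm]
      have : m * (2 * m / 2 * d) = m * m * d := by ring
      rw [this]
      exact abs_le.2 ⟨hlb, hub⟩
    exact le_of_mul_le_mul_left h3 hmpos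

end Ergodicity

section NormE

variable {π' : X → ℝ} {P P' : Matrix X X ℝ}

omit [DecidableEq X] in
/-- `‖π̃E‖₁ ≤ ‖E‖_∞` for a probability vector `π̃` (`‖E‖_∞ ≤ ε` meaning every absolute row sum of
`E = P̃ − P` is `≤ ε`). [cite: KirklandNeumann2012, §5.3 proof of Theorem 5.3.5
("`‖Eᵗw̃‖₁ ≤ ‖w̃‖₁‖Eᵗ‖₁ = ‖E‖_∞`")] -/
theorem norm_vecMul_sub_le (hπ'0 : ∀ x, 0 ≤ π' x) (hπ'1 : ∑ x, π' x = 1) {ε : ℝ}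
    (hE : ∀ x, ∑ y, |P' x y - P x y| ≤ ε) : ∑ y, |(π' ᵥ* (P' - P)) y| ≤ ε :=
  calc ∑ y, |(π' ᵥ* (P' - P)) y| = ∑ y, |∑ x, π' x * (P' x y - P x y)| := by
        simp only [vecMul_apply', Matrix.sub_apply]
    _ ≤ ∑ y, ∑ x, π' x * |P' x y - P x y| := by
        refine sum_le_sum fun y _ => (abs_sum_le_sum_abs _ _).trans (le_of_eq ?_)
        exact sum_congr rfl fun x _ => by rw [abs_mul, abs_of_nonneg (hπ'0 x)]
    _ = ∑ x, π' x * ∑ y, |P' x y - P x y| := by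
        rw [sum_comm]
        exact sum_congr rfl fun x _ => by rw [mul_sum]
    _ ≤ ∑ x, π' x * ε := sum_le_sum fun x _ => mul_le_mul_of_nonneg_left (hE x) (hπ'0 x)
    _ = ε := by rw [← sum_mul, hπ'1, one_mul]

end NormE

/-! ## Dobrushin contraction and Seneta's 1988 bound `‖π̃ − π‖₁ ≤ ‖E‖_∞ / (1 − τ(P))` -/

section Contraction

variable {P P' : Matrix X X ℝ} {π π' μ ν : X → ℝ}

omit [DecidableEq X]

/-- **DOBRUSHIN CONTRACTION** (the defining property of `τ₁` as a Lipschitz constant on the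
zero-sum hyperplane): `‖μB − νB‖₁ ≤ τ(B) ‖μ − ν‖₁` whenever `Σμ = Σν`; for a stochastic `B` this
sharpens `‖μP − νP‖_TV ≤ ‖μ − ν‖_TV` (`TotalVariation.tvDist_stepLaw_le`) by the factor `τ(P) ≤ 1`.
[cite: KirklandNeumann2012, §5.3 Remark 5.3.7 ("`τ(A) = max{‖Aᵗv‖₁ : vᵗ1 = 0, ‖v‖₁ = 1}`")];
[cite: FasinoTudisco2020, §4.1 (definition of `τ_p` as the best Lipschitz constant on `S₁`)] -/
theorem norm_vecMul_sub_vecMul_le (h : ∑ x, μ x = ∑ x, ν x) (B : Matrix X X ℝ) :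
    ∑ k, |(μ ᵥ* B) k - (ν ᵥ* B) k| ≤ ergodicCoeff B * ∑ x, |μ x - ν x| := by
  have hv : ∑ x, (μ - ν) x = 0 := by simp only [Pi.sub_apply, sum_sub_distrib, h, sub_self]
  have h1 := norm_vecMul_le_mul_ergodicCoeff hv B
  rw [sub_vecMul] at h1
  simpa [mul_comm] using h1

/-- The contraction in total variation for the one-step map of `TotalVariation.lean`:
`‖μP − νP‖_TV ≤ τ(P) ‖μ − ν‖_TV` (`Σμ = Σν`). [cite: FasinoTudisco2020, §4.1 Theorem 3
("`‖x_t − x‖_p ≤ τ_p(P)ᵗ ‖x_0 − x‖_p`")]; [cite: KirklandNeumann2012, §5.3 Remark 5.3.7] -/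
theorem tvDist_stepLaw_le_mul (h : ∑ x, μ x = ∑ x, ν x) (P : Matrix X X ℝ) :
    tvDist (stepLaw P μ) (stepLaw P ν) ≤ ergodicCoeff P * tvDist μ ν := by
  have h1 := norm_vecMul_sub_vecMul_le h P
  have h2 : stepLaw P μ = μ ᵥ* P := rfl
  have h3 : stepLaw P ν = ν ᵥ* P := rfl
  unfold tvDist
  rw [h2, h3]
  nlinarith [ergodicCoeff_nonneg P]

/-- Row overlap: for stochastic rows, `Σ_k |P_ik − P_jk| = 2 − 2 Σ_k min(P_ik, P_jk)`.
[cite: FasinoTudisco2020, §4.1 Theorem 4 ("`τ₁(P) = 1 − min_{jk} Σ_i min{P_ij, P_ik}`")] -/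
theorem rowDiff_eq_two_sub (hP : IsRowStochastic P) (i j : X) :
    ∑ k, |P i k - P j k| = 2 - 2 * ∑ k, min (P i k) (P j k) := by
  have h : ∀ k, |P i k - P j k| = P i k + P j k - 2 * min (P i k) (P j k) := fun k => by
    rw [← max_sub_min_eq_abs', ← min_add_max (P i k) (P j k)]; ring
  simp_rw [h, sum_sub_distrib, sum_add_distrib, hP.2 i, hP.2 j, ← mul_sum]
  ring

/-- `τ(P) ≤ 1` for a row-stochastic `P`. [cite: FasinoTudisco2020, §4.1 Theorem 1
(`τ_p(P) ≤ ‖P‖_p`), Theorem 4] -/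
theorem ergodicCoeff_le_one (hP : IsRowStochastic P) : ergodicCoeff P ≤ 1 := by
  refine ergodicCoeff_le zero_le_one fun i j => ?_
  rw [rowDiff_eq_two_sub hP]
  have : 0 ≤ ∑ k, min (P i k) (P j k) := sum_nonneg fun k _ => le_min (hP.1 i k) (hP.1 j k)
  linarith

/-- Uniform row overlap `Σ_k min(P_ik, P_jk) ≥ δ` gives `τ(P) ≤ 1 − δ` (Dobrushin's formula
`τ₁(P) = 1 − min_{i,j} Σ_k min(P_ik, P_jk)`). [cite: FasinoTudisco2020, §4.1 Theorem 4] -/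
theorem ergodicCoeff_le_one_sub [Nonempty X] (hP : IsRowStochastic P) {δ : ℝ}
    (h : ∀ i j, δ ≤ ∑ k, min (P i k) (P j k)) : ergodicCoeff P ≤ 1 - δ := by
  obtain ⟨i₀⟩ := ‹Nonempty X›
  have hδ1 : δ ≤ 1 := (h i₀ i₀).trans (by simp [hP.2 i₀])
  refine ergodicCoeff_le (by linarith) fun i j => ?_
  rw [rowDiff_eq_two_sub hP]
  linarith [h i j]

/-- DOEBLIN MINORISATION `P_ik ≥ δ ν_k` (all `i, k`; `ν` a probability vector) gives
`τ(P) ≤ 1 − δ`. [cite: FasinoTudisco2020, §4.1 Theorem 4]; [cite: LevinPeres2017, §4.4 and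
Theorem 4.9 (the coupling/minorisation mechanism)] -/
theorem ergodicCoeff_le_one_sub_of_minorised (hP : IsRowStochastic P) {δ : ℝ} {ν : X → ℝ}
    (hν1 : ∑ k, ν k = 1) (hmin : ∀ i k, δ * ν k ≤ P i k) :
    ergodicCoeff P ≤ 1 - δ := by
  haveI := nonempty_of_sum_eq_one hν1
  refine ergodicCoeff_le_one_sub hP fun i j => ?_
  calc δ = ∑ k, δ * ν k := by rw [← mul_sum, hν1, mul_one]
    _ ≤ ∑ k, min (P i k) (P j k) := sum_le_sum fun k _ => le_min (hmin i k) (hmin j k)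

/-- **SENETA'S 1988 PERTURBATION BOUND**: if `πP = π`, `π̃P̃ = π̃` (probability vectors) and
`τ(P) < 1`, then `‖π̃ − π‖₁ ≤ ‖P̃ − P‖_∞ / (1 − τ(P))` — no irreducibility and no group inverse
needed (`π̃ − π = (π̃ − π)P + π̃E`, contract and absorb). [cite: FasinoTudisco2020, §4.1 Theorem 2
("`‖x − x′‖_p ≤ ‖P − P′‖_p / (1 − τ_p(P))`", Seneta 1988)]; [cite: Seneta1988, (the theorem of
the note — restated as FasinoTudisco2020 Thm 2; original not read)] -/
theorem norm_sub_le_div_one_sub_ergodicCoeff [DecidableEq X] (hπ1 : ∑ x, π x = 1)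
    (hst : IsStationary π P) (hπ'0 : ∀ x, 0 ≤ π' x) (hπ'1 : ∑ x, π' x = 1)
    (hst' : IsStationary π' P') (hτ : ergodicCoeff P < 1) {ε : ℝ}
    (hE : ∀ x, ∑ y, |P' x y - P x y| ≤ ε) :
    ∑ y, |π' y - π y| ≤ ε / (1 - ergodicCoeff P) := by
  -- `π̃ − π = (π̃ − π)P + π̃E`
  have hdec : π' - π = (π' ᵥ* P - π ᵥ* P) + π' ᵥ* (P' - P) := by
    rw [(funext hst : π ᵥ* P = π), vecMul_sub, (funext hst' : π' ᵥ* P' = π')]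
    abel
  have hmass : ∑ x, π' x = ∑ x, π x := by rw [hπ1, hπ'1]
  have h1 : ∑ y, |π' y - π y|
      ≤ ergodicCoeff P * ∑ y, |π' y - π y| + ε :=
    calc ∑ y, |π' y - π y| = ∑ y, |((π' ᵥ* P - π ᵥ* P) + π' ᵥ* (P' - P)) y| := by
          rw [← hdec]; rfl
      _ ≤ ∑ y, (|(π' ᵥ* P) y - (π ᵥ* P) y| + |(π' ᵥ* (P' - P)) y|) :=
          sum_le_sum fun y _ => abs_add_le _ _
      _ = ∑ y, |(π' ᵥ* P) y - (π ᵥ* P) y| + ∑ y, |(π' ᵥ* (P' - P)) y| := sum_add_distrib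
      _ ≤ ergodicCoeff P * ∑ y, |π' y - π y| + ε :=
          add_le_add (norm_vecMul_sub_vecMul_le hmass P) (norm_vecMul_sub_le hπ'0 hπ'1 hE)
  have hpos : 0 < 1 - ergodicCoeff P := by linarith
  rw [le_div_iff₀ hpos]
  nlinarith

end Contraction

end Literature.Probability.MarkovChains
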